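import Mathlib.Algebra.Polynomial.Coeff
import Mathlib.Algebra.Polynomial.Eval.Coeff
import Mathlib.Analysis.SpecialFunctions.Log.Base
import Literature.Computability.AlgebraicComplexity.MatrixMultiplicationExponent
import HarnessLib

/-!
# Border rank over `K[ε]`, Bini's theorem and Schönhage's `τ`-theorem (Bläser 2013, §6–7)

Topic: `Literature/Computability/AlgebraicComplexity`. Fact item `wi-04449` (MatrixMultiplication
survey): the algebraic (any field) border rank `R_h(t)`, `bR(t) = min_h R_h(t)` of Bläser's survey,
Def. 6.1, with the elementary Remark 6.2 proved, and the named facts Lemma 6.4 (border rank to rank,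
`R(t) ≤ c_h R_h(t)`, `c_h ≤ C(h+2, 2)`), Theorem 6.6 (Bini: `bR(⟨k,m,n⟩) ≤ r ⇒ ω ≤ 3 log_{kmn} r`) and
Theorem 7.5 (Schönhage's `τ`-theorem / asymptotic sum inequality: `bR(⊕ᵢ ⟨kᵢ,mᵢ,nᵢ⟩) ≤ r`, `r > p`
`⇒ ω ≤ 3τ` where `∑ᵢ (kᵢ mᵢ nᵢ)^τ = r`), in the coordinate format of
`MatrixMultiplicationExponent.lean` (`triad`, `tensorRank`, `matMulTensor`, `omega`).

## Content (Bläser 2013 numbering)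

* `IsApproxDecomposition h t u v w` — `∑_ρ u_ρ ⊗ v_ρ ⊗ w_ρ = ε^h t + O(ε^{h+1})` for vectors
  `u_ρ ∈ K[ε]^ι`, `v_ρ ∈ K[ε]^κ`, `w_ρ ∈ K[ε]^μ` (Def. 6.1(1), coefficientwise).
* `approxRank h t = R_h(t)`, `algBorderRank t = bR(t) = min_h R_h(t)` (Def. 6.1).
* `approxRank_zero : R_0(t) = R(t)` and `approxRank_succ_le : R_{h+1}(t) ≤ R_h(t)`,
  `algBorderRank_le_tensorRank` (Remark 6.2, proved).
* `matMulDirectSum K k m n = ⊕_{i<p} ⟨kᵢ, mᵢ, nᵢ⟩` — independent matrix products as one block-diagonal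
  coordinate tensor (§7, first paragraph).
* Named facts: `Blaser2013_lemma64`, `Blaser2013_thm66` (Bini 1980), `Blaser2013_thm75`
  (Schönhage 1981, the `τ`-theorem).

## Design choices and wording risks

* This is the *algebraic* border rank over an arbitrary field (Bläser Def. 6.1, via `K[ε]`), the
  notion in which Thms. 6.6 and 7.5 are stated and proved for every `K`; the topological border rank
  over `ℂ` (limits of rank-`≤ r` tensors) is a different definition, classically equivalent over `ℂ`
  (not asserted here).
* Thm. 6.6 divides by `log (kmn)`: the vendored statement assumes `2 ≤ kmn` and `1 ≤ r` (for
  `kmn = 1` or `r = 0` the printed bound is meaningless; `Real.logb` would return junk).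
* Thm. 7.5 is vendored exactly in Bläser's form "`ω ≤ 3τ` where `τ` is defined by
  `∑ (kᵢ mᵢ nᵢ)^τ = r`": for every real `τ` solving that equation, `ω ≤ 3τ` (the solution is unique
  when some `kᵢmᵢnᵢ ≥ 2`, and does not exist otherwise since `r > p`).
* Junk values: `R_h(t) = 0` if no approximate decomposition exists (impossible for finite index
  types, `approxRank_le_tensorRank`); the facts quantify over finite index types only.
-/

noncomputable section

open scoped BigOperators Polynomial

namespace Literature.Computability.AlgebraicComplexity

universe u v₁ v₂ v₃

/-! ## Approximate decompositions and border rank over `K[ε]` (Bläser Def. 6.1) -/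

section BorderRank

variable {K : Type u} [CommSemiring K] {ι : Type v₁} {κ : Type v₂} {μ : Type v₃}

/-- `(u, v, w)` is an *approximate decomposition of order `h`* of `t` with `r` triads over `K[ε]`:
`∑_{ρ<r} u_ρ ⊗ v_ρ ⊗ w_ρ = ε^h t + O(ε^{h+1})`, i.e. entrywise the polynomial
`∑_ρ u_ρ(a) v_ρ(b) w_ρ(c) ∈ K[ε]` has vanishing coefficients below degree `h` and coefficient
`t_{abc}` in degree `h` (Bläser 2013, Def. 6.1(1)). [cite: Blaser2013, Def. 6.1] -/
def IsApproxDecomposition (h : ℕ) (t : ι → κ → μ → K) {r : ℕ} (u : Fin r → ι → K[X])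
    (v : Fin r → κ → K[X]) (w : Fin r → μ → K[X]) : Prop :=
  ∀ a b c, ∀ j ≤ h, (∑ ρ, u ρ a * v ρ b * w ρ c).coeff j = if j = h then t a b c else 0

/-- **`R_h(t)`**, the order-`h` approximate rank: the least `r` admitting an approximate
decomposition of order `h` with `r` triads over `K[ε]` (Bläser 2013, Def. 6.1(1)). Junk value `0`
if none exists (impossible for finite index types). [cite: Blaser2013, Def. 6.1] -/
def approxRank (h : ℕ) (t : ι → κ → μ → K) : ℕ :=
  sInf {r : ℕ | ∃ (u : Fin r → ι → K[X]) (v : Fin r → κ → K[X]) (w : Fin r → μ → K[X]),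
    IsApproxDecomposition h t u v w}

/-- **Border rank** `bR(t) = min_h R_h(t)` over `K[ε]` (Bläser 2013, Def. 6.1(2)).
[cite: Blaser2013, Def. 6.1] -/
def algBorderRank (t : ι → κ → μ → K) : ℕ :=
  ⨅ h : ℕ, approxRank h t

/-- An approximate decomposition of order `h` with `r` triads bounds `R_h(t)` by `r`.
[cite: Blaser2013, Def. 6.1] -/
theorem approxRank_le_of_isApproxDecomposition {h : ℕ} {t : ι → κ → μ → K} {r : ℕ}
    {u : Fin r → ι → K[X]} {v : Fin r → κ → K[X]} {w : Fin r → μ → K[X]}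
    (huvw : IsApproxDecomposition h t u v w) : approxRank h t ≤ r :=
  Nat.sInf_le ⟨u, v, w, huvw⟩

/-- `bR(t) ≤ R_h(t)` for every `h`. [cite: Blaser2013, Rem. 6.2] -/
theorem algBorderRank_le_approxRank (h : ℕ) (t : ι → κ → μ → K) : algBorderRank t ≤ approxRank h t :=
  ciInf_le ⟨0, fun _ ⟨_, e⟩ => e ▸ Nat.zero_le _⟩ h

/-- An exact decomposition is an approximate decomposition of order `0` (constant polynomials).
[cite: Blaser2013, Rem. 6.2] -/
theorem isApproxDecomposition_zero_C {t : ι → κ → μ → K} {r : ℕ} {w : Fin r → ι → K}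
    {u : Fin r → κ → K} {v : Fin r → μ → K} (e : t = ∑ i, triad (w i) (u i) (v i)) :
    IsApproxDecomposition 0 t (fun i a => Polynomial.C (w i a)) (fun i b => Polynomial.C (u i b))
      (fun i c => Polynomial.C (v i c)) := by
  intro a b c j hj
  obtain rfl : j = 0 := Nat.le_zero.1 hj
  simp only [← Polynomial.C_mul, if_true, Polynomial.finsetSum_coeff, Polynomial.coeff_C_zero]
  rw [e]
  simp [Finset.sum_apply, triad_apply]

/-- The constant terms of an order-`0` approximate decomposition form an exact decomposition.
[cite: Blaser2013, Rem. 6.2] -/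
theorem eq_sum_triad_of_isApproxDecomposition_zero {t : ι → κ → μ → K} {r : ℕ}
    {u : Fin r → ι → K[X]} {v : Fin r → κ → K[X]} {w : Fin r → μ → K[X]}
    (huvw : IsApproxDecomposition 0 t u v w) :
    t = ∑ i, triad (fun a => (u i a).coeff 0) (fun b => (v i b).coeff 0) (fun c => (w i c).coeff 0) := by
  funext a b c
  have h := huvw a b c 0 le_rfl
  simp only [if_true] at h
  rw [← h, Finset.sum_apply, Finset.sum_apply, Finset.sum_apply, Polynomial.finsetSum_coeff]
  refine Finset.sum_congr rfl fun i _ => ?_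
  simp [triad_apply, Polynomial.coeff_zero_eq_eval_zero]

/-- **Remark 6.2(1)**: `R_0(t) = R(t)`. [cite: Blaser2013, Rem. 6.2] -/
theorem approxRank_zero (t : ι → κ → μ → K) : approxRank 0 t = tensorRank t := by
  unfold approxRank tensorRank
  congr 1
  ext r
  constructor
  · rintro ⟨u, v, w, huvw⟩
    exact ⟨_, _, _, eq_sum_triad_of_isApproxDecomposition_zero huvw⟩
  · rintro ⟨w, u, v, e⟩
    exact ⟨_, _, _, isApproxDecomposition_zero_C e⟩

/-- Multiplying the first factor by `ε` turns an order-`h` approximate decomposition into an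
order-`h+1` one. [cite: Blaser2013, Rem. 6.2] -/
theorem IsApproxDecomposition.succ {h : ℕ} {t : ι → κ → μ → K} {r : ℕ} {u : Fin r → ι → K[X]}
    {v : Fin r → κ → K[X]} {w : Fin r → μ → K[X]} (huvw : IsApproxDecomposition h t u v w) :
    IsApproxDecomposition (h + 1) t (fun i a => Polynomial.X * u i a) v w := by
  intro a b c j hj
  have hsum : (∑ ρ, Polynomial.X * u ρ a * v ρ b * w ρ c) =
      Polynomial.X * ∑ ρ, u ρ a * v ρ b * w ρ c := by
    rw [Finset.mul_sum]
    exact Finset.sum_congr rfl fun ρ _ => by ring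
  rw [hsum]
  rcases j with _ | j
  · simp
  · rw [Polynomial.coeff_X_mul, huvw a b c j (by omega)]
    simp

/-- **Remark 6.2(2)**: `R_{h+1}(t) ≤ R_h(t)` (when `R_h(t)` is attained, e.g. finite index types).
[cite: Blaser2013, Rem. 6.2] -/
theorem approxRank_succ_le {h : ℕ} {t : ι → κ → μ → K}
    (hne : ∃ (r : ℕ) (u : Fin r → ι → K[X]) (v : Fin r → κ → K[X]) (w : Fin r → μ → K[X]),
      IsApproxDecomposition h t u v w) :
    approxRank (h + 1) t ≤ approxRank h t := by
  obtain ⟨u, v, w, huvw⟩ := Nat.sInf_mem (s := {r : ℕ | ∃ (u : Fin r → ι → K[X])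
    (v : Fin r → κ → K[X]) (w : Fin r → μ → K[X]), IsApproxDecomposition h t u v w}) hne
  exact approxRank_le_of_isApproxDecomposition huvw.succ

/-- `bR(t) ≤ R(t)` (via `R_0 = R`). [cite: Blaser2013, Rem. 6.2] -/
theorem algBorderRank_le_tensorRank (t : ι → κ → μ → K) : algBorderRank t ≤ tensorRank t :=
  (algBorderRank_le_approxRank 0 t).trans (approxRank_zero t).le

/-- Over finite index types `R_h(t) ≤ |ι|·|κ|·|μ|` for every `h` (iterate `ε`-shifts of the coordinate
decomposition), so all the infima above are attained. [cite: Blaser2013, Rem. 6.2] -/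
theorem exists_isApproxDecomposition [Fintype ι] [Fintype κ] [Fintype μ] [DecidableEq ι] [DecidableEq κ]
    [DecidableEq μ] (h : ℕ) (t : ι → κ → μ → K) :
    ∃ (r : ℕ) (u : Fin r → ι → K[X]) (v : Fin r → κ → K[X]) (w : Fin r → μ → K[X]),
      IsApproxDecomposition h t u v w := by
  induction h with
  | zero =>
    -- the coordinate decomposition `t = ∑_{a,b,c} t_{abc} e_a ⊗ e_b ⊗ e_c`, reindexed by `Fin`
    set e := Fintype.equivFin (ι × κ × μ)
    have key : t = ∑ i : Fin (Fintype.card (ι × κ × μ)),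
        triad (Pi.single (e.symm i).1 (t (e.symm i).1 (e.symm i).2.1 (e.symm i).2.2))
          (Pi.single (e.symm i).2.1 (1 : K)) (Pi.single (e.symm i).2.2 (1 : K)) := by
      have key' : t = ∑ p : ι × κ × μ, triad (Pi.single p.1 (t p.1 p.2.1 p.2.2))
          (Pi.single p.2.1 (1 : K)) (Pi.single p.2.2 (1 : K)) := by
        funext a b c
        rw [Finset.sum_apply, Finset.sum_apply, Finset.sum_apply]
        simp only [triad_apply]
        rw [Fintype.sum_eq_single (a, b, c)]
        · simp
        · rintro ⟨a', b', c'⟩ hne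
          by_cases ha : a' = a
          · subst ha
            by_cases hb : b' = b
            · subst hb
              have hc : c' ≠ c := fun h => hne (by subst h; rfl)
              simp [Ne.symm hc]
            · simp [Pi.single_apply, Ne.symm hb]
          · simp [Pi.single_apply, Ne.symm ha]
      exact key'.trans (Fintype.sum_equiv e _ _ fun p => by simp [e])
    exact ⟨_, _, _, _, isApproxDecomposition_zero_C key⟩
  | succ h ih =>
    obtain ⟨r, u, v, w, huvw⟩ := ih
    exact ⟨r, _, v, w, huvw.succ⟩

/-- `R_h(t) ≤ R(t)` for finite index types. [cite: Blaser2013, Rem. 6.2] -/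
theorem approxRank_le_tensorRank [Fintype ι] [Fintype κ] [Fintype μ] [DecidableEq ι] [DecidableEq κ]
    [DecidableEq μ] (h : ℕ) (t : ι → κ → μ → K) : approxRank h t ≤ tensorRank t := by
  induction h with
  | zero => exact (approxRank_zero t).le
  | succ h ih => exact (approxRank_succ_le (exists_isApproxDecomposition h t)).trans ih

end BorderRank

/-! ## Direct sums of matrix multiplication tensors -/

section DirectSum

variable (K : Type u) [CommSemiring K] {p : ℕ}

/-- The direct sum `⊕_{i<p} ⟨kᵢ, mᵢ, nᵢ⟩` of matrix multiplication tensors, i.e. `p` independent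
matrix products viewed as one block-diagonal partial matrix multiplication (Bläser 2013, §7, first
paragraph): on the index types `Σ i, Fin kᵢ × Fin nᵢ`, `Σ i, Fin kᵢ × Fin mᵢ`, `Σ i, Fin mᵢ × Fin nᵢ`
the entry is `1` iff the three block indices agree and, inside the block, the indices match as in
`matMulTensor` (`κ = κ'`, `μ = μ'`, `ν = ν'`), else `0`. [cite: Blaser2013, §7] -/
def matMulDirectSum (k m n : Fin p → ℕ) :
    (Σ i, Fin (k i) × Fin (n i)) → (Σ i, Fin (k i) × Fin (m i)) → (Σ i, Fin (m i) × Fin (n i)) → K :=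
  fun a b c =>
    if a.1 = b.1 ∧ b.1 = c.1 ∧ (a.2.1 : ℕ) = b.2.1 ∧ (b.2.2 : ℕ) = c.2.1 ∧ (a.2.2 : ℕ) = c.2.2
    then 1 else 0

/-- Inside one block the direct sum is the matrix multiplication tensor of that block.
[cite: Blaser2013, §7] -/
theorem matMulDirectSum_block (k m n : Fin p → ℕ) (i : Fin p) (a : Fin (k i) × Fin (n i))
    (b : Fin (k i) × Fin (m i)) (c : Fin (m i) × Fin (n i)) :
    matMulDirectSum K k m n ⟨i, a⟩ ⟨i, b⟩ ⟨i, c⟩ = matMulTensor K (k i) (m i) (n i) a b c := by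
  simp [matMulDirectSum, matMulTensor, Fin.ext_iff]

/-- Entries with two different block indices vanish. [cite: Blaser2013, §7] -/
theorem matMulDirectSum_of_ne (k m n : Fin p → ℕ) {a : Σ i, Fin (k i) × Fin (n i)}
    {b : Σ i, Fin (k i) × Fin (m i)} {c : Σ i, Fin (m i) × Fin (n i)} (h : a.1 ≠ b.1 ∨ b.1 ≠ c.1) :
    matMulDirectSum K k m n a b c = 0 := by
  unfold matMulDirectSum
  rcases h with h | h <;> simp [h]

end DirectSum

/-! ## Named facts (Bläser 2013, Lemma 6.4, Thm. 6.6, Thm. 7.5) -/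

section Facts

/-- **Bläser 2013, Lemma 6.4** (border rank to rank): for every `h` there is a constant `c_h`, with
`c_h ≤ C(h+2, 2)`, such that `R(t) ≤ c_h · R_h(t)` for all tensors `t` (over any field; finite
formats). [cite: Blaser2013, Lemma 6.4] -/
def Blaser2013_lemma64 : Prop :=
  ∀ (K : Type u) [Field K] (h : ℕ), ∃ c : ℕ, c ≤ Nat.choose (h + 2) 2 ∧
    ∀ {ι κ μ : Type u} [Fintype ι] [Fintype κ] [Fintype μ] [DecidableEq ι] [DecidableEq κ]
      [DecidableEq μ] (t : ι → κ → μ → K), tensorRank t ≤ c * approxRank h t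

/-- **Bläser 2013, Theorem 6.6** (Bini 1980): if `bR(⟨k, m, n⟩) ≤ r` then `ω ≤ 3 log_{kmn} r`
(here with the implicit side conditions `kmn ≥ 2`, `r ≥ 1` made explicit).
[cite: Blaser2013, Thm. 6.6] -/
def Blaser2013_thm66 : Prop :=
  ∀ (K : Type u) [Field K] (k m n r : ℕ), 2 ≤ k * m * n → 1 ≤ r →
    algBorderRank (matMulTensor K k m n) ≤ r →
      omega K ≤ 3 * Real.logb (k * m * n : ℕ) r

/-- **Bläser 2013, Theorem 7.5 — Schönhage's `τ`-theorem** (asymptotic sum inequality, Schönhage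
1981): if `bR(⊕_{i=1}^p ⟨kᵢ, mᵢ, nᵢ⟩) ≤ r` with `r > p`, then `ω ≤ 3τ` where `τ` is defined by
`∑_{i=1}^p (kᵢ mᵢ nᵢ)^τ = r`. [cite: Blaser2013, Thm. 7.5] -/
def Blaser2013_thm75 : Prop :=
  ∀ (K : Type u) [Field K] (p : ℕ) (k m n : Fin p → ℕ) (r : ℕ), p < r →
    algBorderRank (matMulDirectSum K k m n) ≤ r →
      ∀ τ : ℝ, (∑ i, ((k i * m i * n i : ℕ) : ℝ) ^ τ) = r → omega K ≤ 3 * τ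

/-- Thm. 6.6 for cubic formats: `bR(⟨n,n,n⟩) ≤ r`, `n ≥ 2`, `r ≥ 1` `⇒ ω ≤ 3 log_{n³} r = log_n r`
(the form in which Bini's theorem is usually quoted). [cite: Blaser2013, Thm. 6.6] -/
theorem Blaser2013_thm66.cubic (h66 : Blaser2013_thm66.{u}) (K : Type u) [Field K] {n r : ℕ}
    (hn : 2 ≤ n) (hr : 1 ≤ r) (hR : algBorderRank (matMulTensor K n n n) ≤ r) :
    omega K ≤ Real.logb n r := by
  have hnnn : 2 ≤ n * n * n := le_trans hn (le_trans (Nat.le_mul_of_pos_right n (by omega))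
    (Nat.le_mul_of_pos_right _ (by omega)))
  have h := h66 K n n n r hnnn hr hR
  have hcast : ((n * n * n : ℕ) : ℝ) = (n : ℝ) ^ (3 : ℕ) := by push_cast; ring
  rw [hcast, Real.logb, Real.log_pow] at h
  have hlog : 0 < Real.log n := Real.log_pos (by exact_mod_cast hn)
  rw [Real.logb]
  calc omega K ≤ 3 * (Real.log r / (↑(3 : ℕ) * Real.log n)) := h
    _ = Real.log r / Real.log n := by push_cast; field_simp

/-- A rank bound is a border rank bound, so Thm. 6.6 contains `R(⟨n,n,n⟩) ≤ r ⇒ ω ≤ log_n r`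
(Bläser 2013, §5). [cite: Blaser2013, Thm. 6.6] -/
theorem Blaser2013_thm66.of_tensorRank_le (h66 : Blaser2013_thm66.{u}) (K : Type u) [Field K]
    {n r : ℕ} (hn : 2 ≤ n) (hr : 1 ≤ r) (hR : tensorRank (matMulTensor K n n n) ≤ r) :
    omega K ≤ Real.logb n r :=
  h66.cubic K hn hr ((algBorderRank_le_tensorRank _).trans hR)

end Facts

end Literature.Computability.AlgebraicComplexity

end
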